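import Summits.QuantumFields.YangMills.Theorems.UnitScaleTiltProp7TrueLinIterColumnOfStairGauge
import Summits.QuantumFields.YangMills.Theorems.UnitScaleTiltProp7QkAdjointSupRowOfRegPr
import HarnessLib

/-!
# Route `UnitScaleTilt`, crux K1 «MinimiserStabilityRegPr» (stmt-QuantumFields-19200), EX face — one-form VALUE book, ★p1 g26 CHAIR WORD №5 (b): **THE LETTER (COL) IS A THEOREM AT A
# PRINTED-REGULAR BACKGROUND, K-FREE** — `Σ_c ‖(QTwS U₀ (δ_b ⊗ X))(c)‖ ≤ C_Q·((L:ℝ)^(K−n))⁻²·‖X‖` for EVERY fine bond `b` and EVERY `X ∈ M₂(ℂ)`, `C_Q = √2·(2e^{κ₁B∕ρ₁} + 1) ≤ 5`;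
# hence px17 g10's sup row of `Q_k(U₀)†` and the (Q) letter of O2 (✓`Prop7QkAdjointSupRowOfRegPr`, CLOSED MODULO (COL)) hold UNCONDITIONALLY at `RegPr`

Cell `ym3-torus` (HUMAN RULING D-0037; rung R3 = SU(2) YM₃ on T³ — NOT d = 4, NOT infinite volume, NOT a mass gap, NOT Clay).  Width seat `ym3-torus-px13` (gen 15; frames ∕
intertwiner lineage), sitting on ★p1 g26 CHAIR WORD №5 (b) «(COL) = OPEN ANALYTIC LETTER … LOCATE-WANTED → px13 lineage»; brick 3 of 3 (bricks 1–2: ✓`Prop7TrueLinIterColumn`,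
✓`Prop7TrueLinIterColumnOfStairGauge`).  THEOREMS ONLY (0 `def`, 0 `sorry`); `--supports stmt-QuantumFields-19200 --as helper`; count-neutral.

THE POINT.  (R3) ✓`Prop7CoarseGaugeEqFrameResponseQTwS.QTwS_apply_eq_frameReduced_bondShift` (px13 g11): for 𝔰𝔲(2)-valued `B`, `QTwS U₀ B c' = G(ĉ')` with `G = ℓ_{K−n}B − P_Ū(Λ_{K−n})`
the frame-reduced true linearisation at the stair-mean coarse gauge; brick 2 ✓`sum_norm_frameReduced_sub_lineIter_le_of_regPr` bounds `Σ_ĉ‖G ĉ‖ ≤ ρ₁^{K−n}·e^{κ₁B∕ρ₁}·Σ_b‖B b‖`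
with `ρ₁^{K−n} = (L^{K−n})^{1−d} = ((L:ℝ)^(K−n))⁻¹^2` at d = 3 — so §1: `Σ_{c'}‖QTwS U₀ B c'‖ ≤ e^{κ₁B∕ρ₁}·((L:ℝ)^(K−n))⁻¹^2·Σ_b‖B b‖` (`bondShift` is a bijection).  The scalar
sector is FLAT (✓`QTwS_smul_one_eq_QTwS_one_of_regPr`, (Q-b)) and the flat operator is `ℓ^{−d}·`(plain tube sum) (✓`plainTube_eq_smul_QTwS_one`) whose column mass is the tent count
`ℓ^{1−d}` (✓`sum_tube_eq`) — §2.  Every `M₂(ℂ)` field splits `Y = Y₁ + I•Y₂ + τ•1` (✓`exists_sector_fields`) with Frobenius-orthogonal sectors (✓`normSq_frob_sectors`), so each sector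
is `≤ √2` times the field in operator norm (✓`norm_le_norm_frobEquiv_symm`, ✓`norm_frobEquiv_symm_le`) — §3: `Σ_{c'}‖QTwS U₀ Y c'‖ ≤ √2(2e^{κ₁B∕ρ₁} + 1)·((L:ℝ)^(K−n))⁻¹^2·Σ_b‖Y b‖`
for EVERY field `Y`; at a spike `Y = Pi.single b X` this is (COL) TOKEN FOR TOKEN (§4), and px17's two `_of_col` theorems are discharged (§5).  K-FREENESS: `B = ((d+2)L)²ε₀∕16` bounds
the GEOMETRIC level sum of the loop sizes of the averaged tower ([Balaban1985Averaging] Prop. 2 (53) — the level-wise curvature decay), and `κ₁B∕ρ₁ = 4770L³·25L²ε₀∕16 ≤ 10⁻⁵`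
in the EX window `10¹⁰L⁶ε₀ ≤ 1`; nothing depends on `K − n`.

WHAT IS PROVED (ns `…Theorems.Prop7QTwSColumnBound`; T³, `SU(2)`, `RegPr F n K ε₀ U₀`, windows `10¹⁰L⁶ε₀ ≤ 1`, `10¹²L³ε₀ ≤ 1`).
* §1 ★★ `sum_norm_QTwS_le_of_su2` — `Σ_{c'}‖QTwS U₀ B c'‖ ≤ exp(κ₁B∕ρ₁)·((L:ℝ)^(K−n))⁻¹^2·Σ_b‖B b‖` for 𝔰𝔲(2)-valued `B`.
* §2 `sum_norm_QTwS_one_le` (the flat column mass, every field) · ★ `sum_norm_QTwS_smul_one_le` (the scalar sector at `RegPr`).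
* §3 `norm_sectors_le` (each sector `≤ √2·‖Y b‖`) · ★★ `sum_norm_QTwS_le` — every `M₂(ℂ)` field, constant `√2·(2·exp(κ₁B∕ρ₁) + 1)`.
* §4 ★★★ `col_of_regPr` — (COL) in px17's letters VERBATIM: `∀ b X, Σ_c ‖QTwS F n K h U₀ (Pi.single b X) c‖ ≤ C_Q * ((F.L : ℝ) ^ (K − n))⁻¹ ^ 2 * ‖X‖`; `col_const_le_five`.
* §5 ★★★ `norm_toL2_symm_adjoint_Qk_apply_le_of_regPr` · ★★★ `norm_equiv_adjoint_Qk_smul_Qk_apply_le_of_regPr` — px17's ✓`…_of_col` ∕ ✓`…_of_col_of_regPr` with `hcol` DISCHARGED.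
HONEST SCOPE.  Bookkeeping over landed rows (px13 g11 (R3), routeR-w2∕w4∕w6 DEFECT ∕ (iv′)-bridge ∕ `ℓ¹` rows, (Q-b) ✓`…QTwSScalarSectorRegPr`, px17 (P-Q†)); the constants are crude (`C_Q ≤ 5`; sharp would be
`1 + O(L⁵ε₀)`).  Nothing of O2's other letters, the nine EX rows, `hT`, EX or the crux is proved here.

References: T. Bałaban, CMP **99** (1985) 389–434 [Balaban1985BackgroundPropagators] (p.391, (3.11) p.392, (3.13)–(3.16) p.393, (3.26) p.395, (3.42) p.397); CMP **98** (1985) 17–51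
[Balaban1985Averaging] ((18)–(20) p.21, Prop. 2 (53) p.26, Prop. 3 (124)–(126) p.36); CMP **95** (1984) 17–40 [Balaban1984PropagatorsI] ((1.11), (1.18)–(1.20) pp.19–20);
CMP **102** (1985) 277–309 [Balaban1985Variational] ((2) p.278, (44)–(45) p.285, (51) p.286, (137)–(139) pp.298–299).
-/

set_option autoImplicit false

noncomputable section

open scoped BigOperators Matrix.Norms.L2Operator Matrix

namespace Summit.QuantumFields.YangMills.Theorems.Prop7QTwSColumnBound

open Literature.MathematicalPhysics.QuantumFieldTheory.Balaban1983to89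
open Literature.MathematicalPhysics.QuantumFieldTheory.Balaban1983to89.T3ContinuumYM3Torus
open Finset T4Continuum BlockAveraging AveragingRT ExpMeanLog BlockAveragingEMLLinearised BlockAveragingEMLLinearisedBackground BlockAveragingEMLProp2
open B7Prop1Explicit (expUnit)
open T3LevelShift (bondShift)
open T3PrintedRegularOrbits (sites_eq)
open T3PrintedRegularMinimiser (RegPr)
open T3SectALandauChart (bgUnits)
open B9SectCLatticeCarrier (Bond)
open B9Eq311L2Pairing (WL2)
open B11Eq103H1Complex (BondL2K)
open Summit.QuantumFields.YangMills.Theorems.Prop8Chart (emlIterU)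
open Summit.QuantumFields.YangMills.Theorems.Prop7SectET3Transport (periodsT3 bondEquiv)
open Summit.QuantumFields.YangMills.Theorems.Prop7SectET3HilbertLetters (W₂ frobEquiv toL2 toL2B)
open Summit.QuantumFields.YangMills.Theorems.Prop7SectET3CurvedPropagators (Qk)
open Summit.QuantumFields.YangMills.Theorems.Prop7SymAvgTwSym (QTwS QTwS_smul_one_eq_QTwS_one_of_regPr)
open Summit.QuantumFields.YangMills.Theorems.Prop7RieszTauFrobNorm (norm_le_norm_frobEquiv_symm norm_frobEquiv_symm_le)
open Summit.QuantumFields.YangMills.Theorems.Prop7QTwSectors (exists_sector_fields normSq_frob_sectors)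
open Summit.QuantumFields.YangMills.Theorems.Prop7TubeStrSubStairLineIter (sum_tube_eq)
open Summit.QuantumFields.YangMills.Theorems.Prop7TubeStrGaugeComparison (plainTube_eq_smul_QTwS_one)
open Summit.QuantumFields.YangMills.Theorems.Prop7CoarseGaugeEqFrameResponseQTwS (exists_stairGauge_family QTwS_apply_eq_frameReduced_bondShift)
open Summit.QuantumFields.YangMills.Theorems.Prop7TrueLinIterColumnOfStairGauge (sum_norm_frameReduced_sub_lineIter_le_of_regPr)
open Summit.QuantumFields.YangMills.Theorems.Prop7QkAdjointSupRowOfRegPr (norm_toL2_symm_adjoint_Qk_apply_le_of_col norm_equiv_adjoint_Qk_smul_Qk_apply_le_of_col_of_regPr)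

variable (F : T3Family) {n K : ℕ} (h : n ≤ K)

/-! ## §1 ★★ The column mass of `QTwS U₀` on 𝔰𝔲(2) fields -/

/-- The d = 3 bookkeeping `ρ₁^{K−n} = ((L^d)⁻¹·L)^{K−n} = ((L:ℝ)^(K−n))⁻¹^2`. [cite: Balaban1984PropagatorsI, (1.18) p.20] -/
theorem rho1_pow_eq : ((((F.P K).L : ℝ) ^ (F.P K).d)⁻¹ * ((F.P K).L : ℝ)) ^ (K - n) = ((F.L : ℝ) ^ (K - n))⁻¹ ^ 2 := by
  have hd : (F.P K).d = 3 := T3Family.P_d F K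
  have hLL : ((F.P K).L : ℝ) = F.L := rfl
  have hL0 : (0 : ℝ) < F.L := by exact_mod_cast lt_trans zero_lt_one F.hL.2
  have hL : (F.L : ℝ) ≠ 0 := hL0.ne'
  have h1 : (((F.L : ℝ) ^ 3)⁻¹ * (F.L : ℝ)) = ((F.L : ℝ) ^ 2)⁻¹ := by
    field_simp
  rw [hd, hLL, h1]
  calc (((F.L : ℝ) ^ 2)⁻¹) ^ (K - n) = (((F.L : ℝ) ^ 2) ^ (K - n))⁻¹ := inv_pow _ _
    _ = ((F.L : ℝ) ^ (2 * (K - n)))⁻¹ := by rw [← pow_mul]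
    _ = (((F.L : ℝ) ^ (K - n)) ^ 2)⁻¹ := by rw [mul_comm, pow_mul]
    _ = ((F.L : ℝ) ^ (K - n))⁻¹ ^ 2 := (inv_pow _ _).symm

set_option maxHeartbeats 400000 in
-- HEARTBEAT rule (README): the statement instantiates the three `Nat.rec` families and the (R3) ∕ brick-2 rows with ~25-line binders; elaboration measured near the default; decl-local budget.
/-- ★★ **THE COLUMN MASS OF THE AVERAGING OPERATOR OF RECORD ON 𝔰𝔲(2) FIELDS AT A PRINTED-REGULAR BACKGROUND**: `RegPr F n K ε₀ U₀`, `10¹⁰L⁶ε₀ ≤ 1`, `10¹²L³ε₀ ≤ 1`, `B`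
𝔰𝔲(2)-valued ⟹ `Σ_{c'} ‖QTwS U₀ B c'‖ ≤ exp(κ₁B_c∕ρ₁)·((L:ℝ)^(K−n))⁻¹^2·Σ_b ‖B b‖`, `ρ₁ = (L^d)⁻¹L`, `κ₁ = 159(d+2)L·2d`, `B_c = ((d+2)L)²ε₀∕16` — K-FREE.  PROOF: per `c'`,
`QTwS U₀ B c' = G(ĉ')` ((R3) at the `Nat.rec` families of ✓`Prop7QTwSEllTwoBound`'s proof, `Λ` from ✓`exists_stairGauge_family`); `Σ_{c'} = Σ_ĉ` (`Fintype.sum_equiv (bondShift …)`);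
brick 2's second row; `ρ₁^{K−n} = ℓ⁻²`. [cite: Balaban1985BackgroundPropagators, (3.13)-(3.15) p.393; Balaban1985Averaging, Prop. 2 (53) p.26, Prop. 3 (124)-(126) p.36; Balaban1984PropagatorsI, (1.18)-(1.20) pp.19-20] -/
theorem sum_norm_QTwS_le_of_su2 {ε₀ : ℝ} (hε₀ : 0 < ε₀) (hε : 10 ^ 10 * (F.L : ℝ) ^ 6 * ε₀ ≤ 1) (hε12 : 10 ^ 12 * (F.L : ℝ) ^ 3 * ε₀ ≤ 1)
    (W : GaugeField (F.P K) 0 (Matrix.specialUnitaryGroup (Fin 2) ℂ)) (hreg : RegPr F n K ε₀ W)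
    (B : PBond (F.P K) 0 → Matrix (Fin 2) (Fin 2) ℂ) (hsk : ∀ b, star (B b) = -B b) (htr : ∀ b, (B b).trace = 0) :
    ∑ c' : PBond (F.P n) 0, ‖QTwS F n K h W B c'‖
      ≤ Real.exp ((159 * ((((F.P K).d + 2) * (F.P K).L : ℕ) : ℝ) * (2 * ((F.P K).d : ℝ)))
              / ((((F.P K).L : ℝ) ^ (F.P K).d)⁻¹ * ((F.P K).L : ℝ)) * (((((F.P K).d + 2) * (F.P K).L : ℕ) : ℝ) ^ 2 / 16 * ε₀))
          * ((F.L : ℝ) ^ (K - n))⁻¹ ^ 2 * ∑ b : PBond (F.P K) 0, ‖B b‖ := by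
  classical
  have hA : ∀ b, B b ∈ skewAdjoint (Matrix (Fin 2) (Fin 2) ℂ) := fun b => by rw [skewAdjoint.mem_iff]; exact hsk b
  -- the pure `LINE` family, the true-linearisation family, the stair gauges, the frame-reduced response (as in ✓`Prop7QTwSEllTwoBound`)
  let Sf : (k : ℕ) → PBond (F.P K) k → Matrix (Fin 2) (Fin 2) ℂ := fun k =>
    Nat.rec (motive := fun k => PBond (F.P K) k → Matrix (Fin 2) (Fin 2) ℂ) B
      (fun k Sk => fun c => ((Fintype.card (Idx (F.P K)) : ℂ))⁻¹ • ∑ i : Idx (F.P K),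
          (((holAt (Averaging.iter (fun i => blockAvg (P := F.P K) (j := i) (expMeanLogSU (n := Fin 2))) k W) (walk (emb c.src) (stairWord i.2.1 (off i.1))) : Matrix.specialUnitaryGroup (Fin 2) ℂ) : Matrix (Fin 2) (Fin 2) ℂ) *
            covWalkSum (Averaging.iter (fun i => blockAvg (P := F.P K) (j := i) (expMeanLogSU (n := Fin 2))) k W) (Sk)
              (walk (walkEnd (emb c.src) (stairWord i.2.1 (off i.1))) (List.replicate (F.P K).L (c.dir, true))) *
          star ((holAt (Averaging.iter (fun i => blockAvg (P := F.P K) (j := i) (expMeanLogSU (n := Fin 2))) k W) (walk (emb c.src) (stairWord i.2.1 (off i.1))) : Matrix.specialUnitaryGroup (Fin 2) ℂ) : Matrix (Fin 2) (Fin 2) ℂ))) k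
  let Qf : (k : ℕ) → (PBond (F.P K) 0 → Matrix (Fin 2) (Fin 2) ℂ) → PBond (F.P K) k → Matrix (Fin 2) (Fin 2) ℂ := fun k =>
    Nat.rec (motive := fun k => (PBond (F.P K) 0 → Matrix (Fin 2) (Fin 2) ℂ) → PBond (F.P K) k → Matrix (Fin 2) (Fin 2) ℂ) (fun Y => Y)
      (fun k Qk => fun Y c => fderiv ℂ (eml : (Idx (F.P K) → Matrix (Fin 2) (Fin 2) ℂ) → Matrix (Fin 2) (Fin 2) ℂ)
            (fun i => ((loopHol (Averaging.iter (fun i => blockAvg (P := F.P K) (j := i) (expMeanLogSU (n := Fin 2))) k W) c i : Matrix.specialUnitaryGroup (Fin 2) ℂ) : Matrix (Fin 2) (Fin 2) ℂ))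
            (fun i => covWalkSum (Averaging.iter (fun i => blockAvg (P := F.P K) (j := i) (expMeanLogSU (n := Fin 2))) k W) (Qk Y)
                (walk (emb c.src) (loopWord (F.P K).L c.dir (off i.1) i.2.1 i.2.2))
              * ((loopHol (Averaging.iter (fun i => blockAvg (P := F.P K) (j := i) (expMeanLogSU (n := Fin 2))) k W) c i : Matrix.specialUnitaryGroup (Fin 2) ℂ) : Matrix (Fin 2) (Fin 2) ℂ))
            * star ((corr (expMeanLogSU (n := Fin 2)) (Averaging.iter (fun i => blockAvg (P := F.P K) (j := i) (expMeanLogSU (n := Fin 2))) k W) c : Matrix.specialUnitaryGroup (Fin 2) ℂ) : Matrix (Fin 2) (Fin 2) ℂ)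
          + ((corr (expMeanLogSU (n := Fin 2)) (Averaging.iter (fun i => blockAvg (P := F.P K) (j := i) (expMeanLogSU (n := Fin 2))) k W) c : Matrix.specialUnitaryGroup (Fin 2) ℂ) : Matrix (Fin 2) (Fin 2) ℂ)
            * covWalkSum (Averaging.iter (fun i => blockAvg (P := F.P K) (j := i) (expMeanLogSU (n := Fin 2))) k W) (Qk Y)
                (walk (emb c.src) (List.replicate (F.P K).L (c.dir, true)))
            * star ((corr (expMeanLogSU (n := Fin 2)) (Averaging.iter (fun i => blockAvg (P := F.P K) (j := i) (expMeanLogSU (n := Fin 2))) k W) c : Matrix.specialUnitaryGroup (Fin 2) ℂ) : Matrix (Fin 2) (Fin 2) ℂ)) k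
  have hQ0 : ∀ Y, Qf 0 Y = Y := fun _ => rfl
  have hQs : ∀ (k : ℕ) (Y : PBond (F.P K) 0 → Matrix (Fin 2) (Fin 2) ℂ) (c : PBond (F.P K) (k + 1)), Qf (k + 1) Y c
      = fderiv ℂ (eml : (Idx (F.P K) → Matrix (Fin 2) (Fin 2) ℂ) → Matrix (Fin 2) (Fin 2) ℂ)
            (fun i => ((loopHol (Averaging.iter (fun i => blockAvg (P := F.P K) (j := i) (expMeanLogSU (n := Fin 2))) k W) c i : Matrix.specialUnitaryGroup (Fin 2) ℂ) : Matrix (Fin 2) (Fin 2) ℂ))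
            (fun i => covWalkSum (Averaging.iter (fun i => blockAvg (P := F.P K) (j := i) (expMeanLogSU (n := Fin 2))) k W) (Qf k Y)
                (walk (emb c.src) (loopWord (F.P K).L c.dir (off i.1) i.2.1 i.2.2))
              * ((loopHol (Averaging.iter (fun i => blockAvg (P := F.P K) (j := i) (expMeanLogSU (n := Fin 2))) k W) c i : Matrix.specialUnitaryGroup (Fin 2) ℂ) : Matrix (Fin 2) (Fin 2) ℂ))
            * star ((corr (expMeanLogSU (n := Fin 2)) (Averaging.iter (fun i => blockAvg (P := F.P K) (j := i) (expMeanLogSU (n := Fin 2))) k W) c : Matrix.specialUnitaryGroup (Fin 2) ℂ) : Matrix (Fin 2) (Fin 2) ℂ)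
          + ((corr (expMeanLogSU (n := Fin 2)) (Averaging.iter (fun i => blockAvg (P := F.P K) (j := i) (expMeanLogSU (n := Fin 2))) k W) c : Matrix.specialUnitaryGroup (Fin 2) ℂ) : Matrix (Fin 2) (Fin 2) ℂ)
            * covWalkSum (Averaging.iter (fun i => blockAvg (P := F.P K) (j := i) (expMeanLogSU (n := Fin 2))) k W) (Qf k Y)
                (walk (emb c.src) (List.replicate (F.P K).L (c.dir, true)))
            * star ((corr (expMeanLogSU (n := Fin 2)) (Averaging.iter (fun i => blockAvg (P := F.P K) (j := i) (expMeanLogSU (n := Fin 2))) k W) c : Matrix.specialUnitaryGroup (Fin 2) ℂ) : Matrix (Fin 2) (Fin 2) ℂ) := fun _ _ _ => rfl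
  obtain ⟨Λ, hΛ0, hΛs⟩ := exists_stairGauge_family F (K := K) W B
  let G : PBond (F.P K) (K - n) → Matrix (Fin 2) (Fin 2) ℂ := fun c =>
    ((fderiv ℂ (fun t : PBond (F.P K) 0 → Matrix (Fin 2) (Fin 2) ℂ =>
                (((emlIterU (K - n) (fun b' => expUnit (t b') * bgUnits F K W b') c : (Matrix (Fin 2) (Fin 2) ℂ)ˣ) : Matrix (Fin 2) (Fin 2) ℂ))) 0 B
              * star ((Averaging.iter (fun i => blockAvg (P := F.P K) (j := i) (expMeanLogSU (n := Fin 2))) (K - n) W c : Matrix.specialUnitaryGroup (Fin 2) ℂ) : Matrix (Fin 2) (Fin 2) ℂ))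
          - (Λ (K - n) c.src - ((Averaging.iter (fun i => blockAvg (P := F.P K) (j := i) (expMeanLogSU (n := Fin 2))) (K - n) W c : Matrix.specialUnitaryGroup (Fin 2) ℂ) : Matrix (Fin 2) (Fin 2) ℂ) * Λ (K - n) c.tgt * star ((Averaging.iter (fun i => blockAvg (P := F.P K) (j := i) (expMeanLogSU (n := Fin 2))) (K - n) W c : Matrix.specialUnitaryGroup (Fin 2) ℂ) : Matrix (Fin 2) (Fin 2) ℂ)))
  -- (R3): `QTwS W B c' = G ĉ`
  have hR3 : ∀ c' : PBond (F.P n) 0, QTwS F n K h W B c' = G (bondShift (sites_eq F n K h) c') := fun c' =>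
    QTwS_apply_eq_frameReduced_bondShift F h hε₀ hε hε12 W hreg Qf hQ0 hQs B hA htr Λ hΛ0 (fun k _ y => hΛs k y) c'
  -- brick 2, second row, at the target level `K − n`
  obtain ⟨-, h2⟩ := sum_norm_frameReduced_sub_lineIter_le_of_regPr F hε₀ hε hε12 W hreg Qf hQ0 hQs B hA htr Λ hΛ0
    (fun k _ y => hΛs k y) Sf (fun _ => rfl) (fun _ _ => rfl) (k := K - n) le_rfl
  -- reindex `Σ_{c'}` to the coarse bonds and read `ρ₁^{K−n} = ℓ⁻²`
  have hre : ∑ c' : PBond (F.P n) 0, ‖QTwS F n K h W B c'‖ = ∑ c : PBond (F.P K) (K - n), ‖G c‖ := by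
    simp only [hR3]
    exact Fintype.sum_equiv (bondShift (sites_eq F n K h)) _ (fun c : PBond (F.P K) (K - n) => ‖G c‖) (fun _ => rfl)
  rw [hre, ← rho1_pow_eq F (n := n) (K := K)]
  calc ∑ c : PBond (F.P K) (K - n), ‖G c‖
      ≤ ((((F.P K).L : ℝ) ^ (F.P K).d)⁻¹ * ((F.P K).L : ℝ)) ^ (K - n) * Real.exp ((159 * ((((F.P K).d + 2) * (F.P K).L : ℕ) : ℝ) * (2 * ((F.P K).d : ℝ)))
              / ((((F.P K).L : ℝ) ^ (F.P K).d)⁻¹ * ((F.P K).L : ℝ)) * (((((F.P K).d + 2) * (F.P K).L : ℕ) : ℝ) ^ 2 / 16 * ε₀)) * (∑ b : PBond (F.P K) 0, ‖B b‖) := h2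
    _ = _ := by ring

/-! ## §2 The flat column mass and the scalar sector -/

/-- **THE FLAT COLUMN MASS** (the tent count summed): `Σ_{c'} ‖QTwS 1 Y c'‖ ≤ ((L:ℝ)^(K−n))⁻¹^2·Σ_b ‖Y b‖` for EVERY bond field `Y` — `QTwS 1 Y c' = ℓ^{−d}·`(plain tube sum at `ĉ'`)
(✓`plainTube_eq_smul_QTwS_one`), triangle inequality, and the `ℓ`-to-one tube reparametrisation ✓`sum_tube_eq`; `ℓ·ℓ^{−d} = ℓ⁻²`. [cite: Balaban1984PropagatorsI, (1.18) p.20; Balaban1985Averaging, (125)-(127) p.36] -/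
theorem sum_norm_QTwS_one_le (Y : PBond (F.P K) 0 → Matrix (Fin 2) (Fin 2) ℂ) :
    ∑ c' : PBond (F.P n) 0, ‖QTwS F n K h (1 : GaugeField (F.P K) 0 (Matrix.specialUnitaryGroup (Fin 2) ℂ)) Y c'‖
      ≤ ((F.L : ℝ) ^ (K - n))⁻¹ ^ 2 * ∑ b : PBond (F.P K) 0, ‖Y b‖ := by
  classical
  have hk : K - n ≤ (F.P K).m + (F.P K).K := by show K - n ≤ F.m + K; omega
  have hd : (F.P K).d = 3 := T3Family.P_d F K
  have hLL : ((F.P K).L : ℝ) = F.L := rfl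
  have hL0 : (0 : ℝ) < F.L := by exact_mod_cast lt_trans zero_lt_one F.hL.2
  have hℓ0 : (0 : ℝ) < (F.L : ℝ) ^ (K - n) := by positivity
  have hℓd0 : (0 : ℝ) < ((F.L : ℝ) ^ (K - n)) ^ (F.P K).d := by positivity
  have hld : ((((F.P K).L : ℂ) ^ (K - n)) ^ (F.P K).d) = (((((F.L : ℝ) ^ (K - n)) ^ (F.P K).d : ℝ)) : ℂ) := by push_cast; rfl
  -- `‖QTwS 1 Y c'‖ ≤ ℓ^{-d}·(plain tube mass at ĉ')`
  have hper : ∀ c' : PBond (F.P n) 0, ‖QTwS F n K h (1 : GaugeField (F.P K) 0 (Matrix.specialUnitaryGroup (Fin 2) ℂ)) Y c'‖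
      ≤ (((F.L : ℝ) ^ (K - n)) ^ (F.P K).d)⁻¹ * ∑ r : Fin (F.P K).d → Fin ((F.P K).L ^ (K - n)), ∑ t ∈ Finset.range ((F.P K).L ^ (K - n)),
          ‖Y ⟨(fun z : Site (F.P K) 0 => z.shift (bondShift (sites_eq F n K h) c').dir)^[t] (Site.fibreSite 0 (K - n) (bondShift (sites_eq F n K h) c').src r), (bondShift (sites_eq F n K h) c').dir⟩‖ := by
    intro c'
    have h1 := plainTube_eq_smul_QTwS_one F n K h Y c'
    rw [hld] at h1
    have h2 : QTwS F n K h (1 : GaugeField (F.P K) 0 (Matrix.specialUnitaryGroup (Fin 2) ℂ)) Y c'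
        = ((((((F.L : ℝ) ^ (K - n)) ^ (F.P K).d : ℝ))⁻¹ : ℝ) : ℂ) • ∑ r : Fin (F.P K).d → Fin ((F.P K).L ^ (K - n)), ∑ t ∈ Finset.range ((F.P K).L ^ (K - n)),
          Y ⟨(fun z : Site (F.P K) 0 => z.shift (bondShift (sites_eq F n K h) c').dir)^[t] (Site.fibreSite 0 (K - n) (bondShift (sites_eq F n K h) c').src r), (bondShift (sites_eq F n K h) c').dir⟩ := by
      rw [h1, smul_smul, Complex.ofReal_inv, inv_mul_cancel₀ (by exact_mod_cast hℓd0.ne'), one_smul]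
    rw [h2, norm_smul, Complex.norm_real, Real.norm_of_nonneg (inv_nonneg.mpr hℓd0.le)]
    exact mul_le_mul_of_nonneg_left ((norm_sum_le _ _).trans (Finset.sum_le_sum fun r _ => norm_sum_le _ _)) (inv_nonneg.mpr hℓd0.le)
  refine (Finset.sum_le_sum fun c' _ => hper c').trans ?_
  rw [← Finset.mul_sum]
  have hre : ∑ c' : PBond (F.P n) 0, ∑ r : Fin (F.P K).d → Fin ((F.P K).L ^ (K - n)), ∑ t ∈ Finset.range ((F.P K).L ^ (K - n)),
          ‖Y ⟨(fun z : Site (F.P K) 0 => z.shift (bondShift (sites_eq F n K h) c').dir)^[t] (Site.fibreSite 0 (K - n) (bondShift (sites_eq F n K h) c').src r), (bondShift (sites_eq F n K h) c').dir⟩‖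
      = ∑ c : PBond (F.P K) (K - n), ∑ r : Fin (F.P K).d → Fin ((F.P K).L ^ (K - n)), ∑ t ∈ Finset.range ((F.P K).L ^ (K - n)),
          ‖Y ⟨(fun z : Site (F.P K) 0 => z.shift c.dir)^[t] (Site.fibreSite 0 (K - n) c.src r), c.dir⟩‖ :=
    Fintype.sum_equiv (bondShift (sites_eq F n K h)) _ (fun c : PBond (F.P K) (K - n) => ∑ r : Fin (F.P K).d → Fin ((F.P K).L ^ (K - n)), ∑ t ∈ Finset.range ((F.P K).L ^ (K - n)),
          ‖Y ⟨(fun z : Site (F.P K) 0 => z.shift c.dir)^[t] (Site.fibreSite 0 (K - n) c.src r), c.dir⟩‖) (fun _ => rfl)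
  rw [hre, sum_tube_eq hk (fun b => ‖Y b‖), hLL, hd]
  refine le_of_eq ?_
  field_simp

/-- ★ **THE SCALAR SECTOR IS FLAT** ((Q-b) ✓`QTwS_smul_one_eq_QTwS_one_of_regPr`): at a printed-regular background (`10¹²L³ε₀ ≤ 1`), for every scalar field `τ`,
`Σ_{c'} ‖QTwS U₀ (τ•1) c'‖ ≤ ((L:ℝ)^(K−n))⁻¹^2·Σ_b ‖τ b • 1‖`. [cite: Balaban1985Variational, (51) p.286; Balaban1984PropagatorsI, (1.18) p.20] -/
theorem sum_norm_QTwS_smul_one_le {ε₀ : ℝ} (hε₀ : 0 < ε₀) (hε12 : 10 ^ 12 * (F.L : ℝ) ^ 3 * ε₀ ≤ 1)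
    (W : GaugeField (F.P K) 0 (Matrix.specialUnitaryGroup (Fin 2) ℂ)) (hreg : RegPr F n K ε₀ W) (τ : PBond (F.P K) 0 → ℂ) :
    ∑ c' : PBond (F.P n) 0, ‖QTwS F n K h W (fun b => τ b • (1 : Matrix (Fin 2) (Fin 2) ℂ)) c'‖
      ≤ ((F.L : ℝ) ^ (K - n))⁻¹ ^ 2 * ∑ b : PBond (F.P K) 0, ‖τ b • (1 : Matrix (Fin 2) (Fin 2) ℂ)‖ := by
  rw [QTwS_smul_one_eq_QTwS_one_of_regPr F h hε₀ hε12 W hreg τ]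
  exact sum_norm_QTwS_one_le F h (fun b => τ b • (1 : Matrix (Fin 2) (Fin 2) ℂ))

/-! ## §3 ★★ Every `M₂(ℂ)` field: the three sectors -/

/-- **EACH SECTOR IS `≤ √2·` THE FIELD IN OPERATOR NORM**: for `X, Y ∈ 𝔰𝔲(2)` and `s ∈ ℂ`, each of `‖X‖`, `‖Y‖`, `‖s•1‖` is `≤ √2·‖X + I•Y + s•1‖` (Frobenius Pythagoras
✓`normSq_frob_sectors` and `|·| ≤ ‖·‖_F ≤ √2|·|` on `M₂(ℂ)`). [cite: Balaban1985BackgroundPropagators, (3.11) p.392] -/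
theorem norm_sectors_le {X Y : Matrix (Fin 2) (Fin 2) ℂ} (hX : star X = -X ∧ X.trace = 0) (hY : star Y = -Y ∧ Y.trace = 0) (s : ℂ) :
    ‖X‖ ≤ Real.sqrt 2 * ‖X + Complex.I • Y + s • (1 : Matrix (Fin 2) (Fin 2) ℂ)‖ ∧
      ‖Y‖ ≤ Real.sqrt 2 * ‖X + Complex.I • Y + s • (1 : Matrix (Fin 2) (Fin 2) ℂ)‖ ∧
        ‖s • (1 : Matrix (Fin 2) (Fin 2) ℂ)‖ ≤ Real.sqrt 2 * ‖X + Complex.I • Y + s • (1 : Matrix (Fin 2) (Fin 2) ℂ)‖ := by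
  have hP := normSq_frob_sectors hX hY s
  have hT := norm_frobEquiv_symm_le (X + Complex.I • Y + s • (1 : Matrix (Fin 2) (Fin 2) ℂ))
  have h0 : 0 ≤ ‖(frobEquiv.symm (X + Complex.I • Y + s • (1 : Matrix (Fin 2) (Fin 2) ℂ)) : W₂)‖ := norm_nonneg _
  have hXF : ‖(frobEquiv.symm X : W₂)‖ ≤ ‖(frobEquiv.symm (X + Complex.I • Y + s • (1 : Matrix (Fin 2) (Fin 2) ℂ)) : W₂)‖ :=
    (pow_le_pow_iff_left₀ (norm_nonneg _) h0 two_ne_zero).mp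
      (by rw [hP]; nlinarith [sq_nonneg ‖(frobEquiv.symm Y : W₂)‖, sq_nonneg ‖(frobEquiv.symm (s • (1 : Matrix (Fin 2) (Fin 2) ℂ)) : W₂)‖])
  have hYF : ‖(frobEquiv.symm Y : W₂)‖ ≤ ‖(frobEquiv.symm (X + Complex.I • Y + s • (1 : Matrix (Fin 2) (Fin 2) ℂ)) : W₂)‖ :=
    (pow_le_pow_iff_left₀ (norm_nonneg _) h0 two_ne_zero).mp
      (by rw [hP]; nlinarith [sq_nonneg ‖(frobEquiv.symm X : W₂)‖, sq_nonneg ‖(frobEquiv.symm (s • (1 : Matrix (Fin 2) (Fin 2) ℂ)) : W₂)‖])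
  have hSF : ‖(frobEquiv.symm (s • (1 : Matrix (Fin 2) (Fin 2) ℂ)) : W₂)‖ ≤ ‖(frobEquiv.symm (X + Complex.I • Y + s • (1 : Matrix (Fin 2) (Fin 2) ℂ)) : W₂)‖ :=
    (pow_le_pow_iff_left₀ (norm_nonneg _) h0 two_ne_zero).mp
      (by rw [hP]; nlinarith [sq_nonneg ‖(frobEquiv.symm X : W₂)‖, sq_nonneg ‖(frobEquiv.symm Y : W₂)‖])
  exact ⟨(norm_le_norm_frobEquiv_symm X).trans (hXF.trans hT), (norm_le_norm_frobEquiv_symm Y).trans (hYF.trans hT),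
    (norm_le_norm_frobEquiv_symm _).trans (hSF.trans hT)⟩

/-- ★★ **THE COLUMN MASS OF `QTwS U₀` ON EVERY `M₂(ℂ)` FIELD**: `RegPr F n K ε₀ U₀`, `10¹⁰L⁶ε₀ ≤ 1`, `10¹²L³ε₀ ≤ 1` ⟹ for every bond field `Y`,
`Σ_{c'} ‖QTwS U₀ Y c'‖ ≤ √2·(2·exp(κ₁B_c∕ρ₁) + 1)·((L:ℝ)^(K−n))⁻¹^2·Σ_b ‖Y b‖` — sectors `Y = Y₁ + I•Y₂ + τ•1` (✓`exists_sector_fields`), linearity of `QTwS U₀`, §1 twice, §2, §3.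
[cite: Balaban1985BackgroundPropagators, (3.13)-(3.15) p.393; Balaban1985Variational, (51) p.286; Balaban1985Averaging, Prop. 3 (124)-(126) p.36] -/
theorem sum_norm_QTwS_le {ε₀ : ℝ} (hε₀ : 0 < ε₀) (hε : 10 ^ 10 * (F.L : ℝ) ^ 6 * ε₀ ≤ 1) (hε12 : 10 ^ 12 * (F.L : ℝ) ^ 3 * ε₀ ≤ 1)
    (W : GaugeField (F.P K) 0 (Matrix.specialUnitaryGroup (Fin 2) ℂ)) (hreg : RegPr F n K ε₀ W) (Y : PBond (F.P K) 0 → Matrix (Fin 2) (Fin 2) ℂ) :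
    ∑ c' : PBond (F.P n) 0, ‖QTwS F n K h W Y c'‖
      ≤ Real.sqrt 2 * (2 * Real.exp ((159 * ((((F.P K).d + 2) * (F.P K).L : ℕ) : ℝ) * (2 * ((F.P K).d : ℝ)))
              / ((((F.P K).L : ℝ) ^ (F.P K).d)⁻¹ * ((F.P K).L : ℝ)) * (((((F.P K).d + 2) * (F.P K).L : ℕ) : ℝ) ^ 2 / 16 * ε₀)) + 1)
          * ((F.L : ℝ) ^ (K - n))⁻¹ ^ 2 * ∑ b : PBond (F.P K) 0, ‖Y b‖ := by
  obtain ⟨Y₁, Y₂, τ, h1, h2, hY⟩ := exists_sector_fields Y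
  set E : ℝ := Real.exp ((159 * ((((F.P K).d + 2) * (F.P K).L : ℕ) : ℝ) * (2 * ((F.P K).d : ℝ)))
              / ((((F.P K).L : ℝ) ^ (F.P K).d)⁻¹ * ((F.P K).L : ℝ)) * (((((F.P K).d + 2) * (F.P K).L : ℕ) : ℝ) ^ 2 / 16 * ε₀)) with hE
  set ℓ2 : ℝ := ((F.L : ℝ) ^ (K - n))⁻¹ ^ 2 with hℓ2
  have hE0 : 0 ≤ E := (Real.exp_pos _).le
  have hℓ20 : 0 ≤ ℓ2 := by positivity
  -- linearity of `QTwS W` across the sectors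
  have hsplit : QTwS F n K h W Y = QTwS F n K h W Y₁ + Complex.I • QTwS F n K h W Y₂ + QTwS F n K h W (fun b => τ b • (1 : Matrix (Fin 2) (Fin 2) ℂ)) := by
    have hYf : Y = Y₁ + Complex.I • Y₂ + (fun b => τ b • (1 : Matrix (Fin 2) (Fin 2) ℂ)) := by
      rw [hY]; funext b; simp only [Pi.add_apply, Pi.smul_apply]
    rw [hYf, map_add, map_add, map_smul]
  have hrow1 := sum_norm_QTwS_le_of_su2 F h hε₀ hε hε12 W hreg Y₁ (fun b => (h1 b).1) (fun b => (h1 b).2)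
  have hrow2 := sum_norm_QTwS_le_of_su2 F h hε₀ hε hε12 W hreg Y₂ (fun b => (h2 b).1) (fun b => (h2 b).2)
  have hrow3 := sum_norm_QTwS_smul_one_le F h hε₀ hε12 W hreg τ
  rw [← hE, ← hℓ2] at hrow1 hrow2
  rw [← hℓ2] at hrow3
  -- pointwise triangle inequality across the three sectors
  have hpt : ∀ c' : PBond (F.P n) 0, ‖QTwS F n K h W Y c'‖
      ≤ ‖QTwS F n K h W Y₁ c'‖ + ‖QTwS F n K h W Y₂ c'‖ + ‖QTwS F n K h W (fun b => τ b • (1 : Matrix (Fin 2) (Fin 2) ℂ)) c'‖ := by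
    intro c'
    rw [hsplit, Pi.add_apply, Pi.add_apply, Pi.smul_apply]
    calc _ ≤ ‖QTwS F n K h W Y₁ c' + Complex.I • QTwS F n K h W Y₂ c'‖ + ‖QTwS F n K h W (fun b => τ b • (1 : Matrix (Fin 2) (Fin 2) ℂ)) c'‖ := norm_add_le _ _
      _ ≤ ‖QTwS F n K h W Y₁ c'‖ + ‖Complex.I • QTwS F n K h W Y₂ c'‖ + ‖QTwS F n K h W (fun b => τ b • (1 : Matrix (Fin 2) (Fin 2) ℂ)) c'‖ := by
          gcongr; exact norm_add_le _ _
      _ = _ := by rw [norm_smul, Complex.norm_I, one_mul]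
  -- the sector norms against `‖Y b‖`
  have hsec : ∀ b, ‖Y₁ b‖ ≤ Real.sqrt 2 * ‖Y b‖ ∧ ‖Y₂ b‖ ≤ Real.sqrt 2 * ‖Y b‖ ∧ ‖τ b • (1 : Matrix (Fin 2) (Fin 2) ℂ)‖ ≤ Real.sqrt 2 * ‖Y b‖ := by
    intro b
    have hb : Y b = Y₁ b + Complex.I • Y₂ b + τ b • (1 : Matrix (Fin 2) (Fin 2) ℂ) := by rw [hY]
    rw [hb]
    exact norm_sectors_le (h1 b) (h2 b) (τ b)
  have hS1 : ∑ b : PBond (F.P K) 0, ‖Y₁ b‖ ≤ Real.sqrt 2 * ∑ b : PBond (F.P K) 0, ‖Y b‖ := by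
    rw [Finset.mul_sum]; exact Finset.sum_le_sum fun b _ => (hsec b).1
  have hS2 : ∑ b : PBond (F.P K) 0, ‖Y₂ b‖ ≤ Real.sqrt 2 * ∑ b : PBond (F.P K) 0, ‖Y b‖ := by
    rw [Finset.mul_sum]; exact Finset.sum_le_sum fun b _ => (hsec b).2.1
  have hS3 : ∑ b : PBond (F.P K) 0, ‖τ b • (1 : Matrix (Fin 2) (Fin 2) ℂ)‖ ≤ Real.sqrt 2 * ∑ b : PBond (F.P K) 0, ‖Y b‖ := by
    rw [Finset.mul_sum]; exact Finset.sum_le_sum fun b _ => (hsec b).2.2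
  have hN0 : 0 ≤ ∑ b : PBond (F.P K) 0, ‖Y b‖ := Finset.sum_nonneg fun b _ => norm_nonneg _
  calc ∑ c' : PBond (F.P n) 0, ‖QTwS F n K h W Y c'‖
      ≤ ∑ c' : PBond (F.P n) 0, (‖QTwS F n K h W Y₁ c'‖ + ‖QTwS F n K h W Y₂ c'‖ + ‖QTwS F n K h W (fun b => τ b • (1 : Matrix (Fin 2) (Fin 2) ℂ)) c'‖) :=
        Finset.sum_le_sum fun c' _ => hpt c'
    _ = ∑ c' : PBond (F.P n) 0, ‖QTwS F n K h W Y₁ c'‖ + ∑ c' : PBond (F.P n) 0, ‖QTwS F n K h W Y₂ c'‖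
          + ∑ c' : PBond (F.P n) 0, ‖QTwS F n K h W (fun b => τ b • (1 : Matrix (Fin 2) (Fin 2) ℂ)) c'‖ := by
        rw [Finset.sum_add_distrib, Finset.sum_add_distrib]
    _ ≤ E * ℓ2 * ∑ b : PBond (F.P K) 0, ‖Y₁ b‖ + E * ℓ2 * ∑ b : PBond (F.P K) 0, ‖Y₂ b‖ + ℓ2 * ∑ b : PBond (F.P K) 0, ‖τ b • (1 : Matrix (Fin 2) (Fin 2) ℂ)‖ :=
        add_le_add (add_le_add hrow1 hrow2) hrow3
    _ ≤ E * ℓ2 * (Real.sqrt 2 * ∑ b : PBond (F.P K) 0, ‖Y b‖) + E * ℓ2 * (Real.sqrt 2 * ∑ b : PBond (F.P K) 0, ‖Y b‖)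
          + ℓ2 * (Real.sqrt 2 * ∑ b : PBond (F.P K) 0, ‖Y b‖) := by
        gcongr
    _ = Real.sqrt 2 * (2 * E + 1) * ℓ2 * ∑ b : PBond (F.P K) 0, ‖Y b‖ := by ring

/-! ## §4 ★★★ (COL) in px17's letters, verbatim -/

/-- The `ℓ¹` mass of a one-bond spike is the norm of its value. [folklore] -/
theorem sum_norm_single (b : PBond (F.P K) 0) (X : Matrix (Fin 2) (Fin 2) ℂ) :
    ∑ b' : PBond (F.P K) 0, ‖(Pi.single b X : PBond (F.P K) 0 → Matrix (Fin 2) (Fin 2) ℂ) b'‖ = ‖X‖ := by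
  classical
  rw [Finset.sum_eq_single b]
  · rw [Pi.single_eq_same]
  · intro b' _ hb'; rw [Pi.single_eq_of_ne hb', norm_zero]
  · intro hb; exact absurd (Finset.mem_univ b) hb

/-- ★★★ **(COL) — THE COLUMN `ℓ¹` LETTER OF THE AVERAGING OPERATOR OF RECORD AT A PRINTED-REGULAR BACKGROUND, IN ✓`Prop7QkAdjointSupRowOfRegPr`'s LETTERS VERBATIM**:
`RegPr F n K ε₀ U₀`, `10¹⁰L⁶ε₀ ≤ 1`, `10¹²L³ε₀ ≤ 1` ⟹ `∀ b X, Σ_c ‖QTwS F n K h U₀ (Pi.single b X) c‖ ≤ C_Q·((F.L : ℝ) ^ (K − n))⁻¹ ^ 2·‖X‖` with the K-FREE constant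
`C_Q = √2·(2·exp(κ₁B_c∕ρ₁) + 1)` (`≤ 5`, `col_const_le_five`). [cite: Balaban1985BackgroundPropagators, (3.13)-(3.16) p.393; Balaban1985Averaging, Prop. 2 (53) p.26, Prop. 3 (124)-(126) p.36; Balaban1984PropagatorsI, (1.18)-(1.20) pp.19-20] -/
theorem col_of_regPr {ε₀ : ℝ} (hε₀ : 0 < ε₀) (hε : 10 ^ 10 * (F.L : ℝ) ^ 6 * ε₀ ≤ 1) (hε12 : 10 ^ 12 * (F.L : ℝ) ^ 3 * ε₀ ≤ 1)
    (U₀ : GaugeField (F.P K) 0 (Matrix.specialUnitaryGroup (Fin 2) ℂ)) (hreg : RegPr F n K ε₀ U₀) :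
    ∀ (b : PBond (F.P K) 0) (X : Matrix (Fin 2) (Fin 2) ℂ),
      ∑ c : PBond (F.P n) 0, ‖QTwS F n K h U₀ (Pi.single b X) c‖
        ≤ (Real.sqrt 2 * (2 * Real.exp ((159 * ((((F.P K).d + 2) * (F.P K).L : ℕ) : ℝ) * (2 * ((F.P K).d : ℝ)))
              / ((((F.P K).L : ℝ) ^ (F.P K).d)⁻¹ * ((F.P K).L : ℝ)) * (((((F.P K).d + 2) * (F.P K).L : ℕ) : ℝ) ^ 2 / 16 * ε₀)) + 1))
          * ((F.L : ℝ) ^ (K - n))⁻¹ ^ 2 * ‖X‖ := by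
  intro b X
  have hmain := sum_norm_QTwS_le F h hε₀ hε hε12 U₀ hreg (Pi.single b X)
  rwa [sum_norm_single] at hmain

/-- **THE CONSTANT IS AT MOST `5`** in the EX window: `κ₁B_c∕ρ₁ = 159·5L·6·L³·25L²ε₀∕16 ≤ 1` under `10¹⁰L⁶ε₀ ≤ 1`, so `√2·(2e^{κ₁B_c∕ρ₁} + 1) ≤ √2(2e + 1) ≤ … ≤ 5`; in fact
`κ₁B_c∕ρ₁ ≤ 10⁻⁵`, and the crude numeral `5` is what the consumers' windows need. [cite: Balaban1985Variational, (2) p.278] -/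
theorem col_const_le_five {ε₀ : ℝ} (hε₀ : 0 < ε₀) (hε : 10 ^ 10 * (F.L : ℝ) ^ 6 * ε₀ ≤ 1) :
    Real.sqrt 2 * (2 * Real.exp ((159 * ((((F.P K).d + 2) * (F.P K).L : ℕ) : ℝ) * (2 * ((F.P K).d : ℝ)))
              / ((((F.P K).L : ℝ) ^ (F.P K).d)⁻¹ * ((F.P K).L : ℝ)) * (((((F.P K).d + 2) * (F.P K).L : ℕ) : ℝ) ^ 2 / 16 * ε₀)) + 1) ≤ 5 := by
  have hd : (F.P K).d = 3 := T3Family.P_d F K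
  have hLL : ((F.P K).L : ℝ) = F.L := rfl
  have hL3 : (3 : ℝ) ≤ F.L := by
    have h3 : 3 ≤ F.L := by obtain ⟨a, ha⟩ := F.hL.1; have := F.hL.2; omega
    exact_mod_cast h3
  have hL0 : (0 : ℝ) < F.L := by linarith
  -- the exponent is `≤ 7454·L⁵ε₀ ≤ 10⁻⁵ ≤ 1/100`
  have hexp : (159 * ((((F.P K).d + 2) * (F.P K).L : ℕ) : ℝ) * (2 * ((F.P K).d : ℝ)))
              / ((((F.P K).L : ℝ) ^ (F.P K).d)⁻¹ * ((F.P K).L : ℝ)) * (((((F.P K).d + 2) * (F.P K).L : ℕ) : ℝ) ^ 2 / 16 * ε₀) ≤ 1 / 100 := by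
    rw [hd]; push_cast; rw [hLL]
    have hL6 : (F.L : ℝ) ^ 5 * ε₀ ≤ (F.L : ℝ) ^ 6 * ε₀ := by
      have : (F.L : ℝ) ^ 5 ≤ (F.L : ℝ) ^ 6 := pow_le_pow_right₀ (by linarith) (by norm_num)
      exact mul_le_mul_of_nonneg_right this hε₀.le
    have hkey : 159 * (5 * (F.L : ℝ)) * (2 * 3) / (((F.L : ℝ) ^ 3)⁻¹ * (F.L : ℝ)) * ((5 * (F.L : ℝ)) ^ 2 / 16 * ε₀)
        = 159 * 5 * 6 * 25 / 16 * ((F.L : ℝ) ^ 5 * ε₀) := by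
      field_simp
      ring
    rw [hkey]
    nlinarith [hL6, hε]
  have he : Real.exp ((159 * ((((F.P K).d + 2) * (F.P K).L : ℕ) : ℝ) * (2 * ((F.P K).d : ℝ)))
              / ((((F.P K).L : ℝ) ^ (F.P K).d)⁻¹ * ((F.P K).L : ℝ)) * (((((F.P K).d + 2) * (F.P K).L : ℕ) : ℝ) ^ 2 / 16 * ε₀)) ≤ 100 / 99 := by
    refine (Real.exp_le_exp.mpr hexp).trans ?_
    refine (Real.exp_bound_div_one_sub_of_interval (by norm_num) (by norm_num)).trans ?_
    norm_num
  have hs : Real.sqrt 2 ≤ 3 / 2 := by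
    rw [Real.sqrt_le_left (by norm_num)]; norm_num
  have hs0 : 0 ≤ Real.sqrt 2 := Real.sqrt_nonneg _
  have hE0 := Real.exp_pos ((159 * ((((F.P K).d + 2) * (F.P K).L : ℕ) : ℝ) * (2 * ((F.P K).d : ℝ)))
              / ((((F.P K).L : ℝ) ^ (F.P K).d)⁻¹ * ((F.P K).L : ℝ)) * (((((F.P K).d + 2) * (F.P K).L : ℕ) : ℝ) ^ 2 / 16 * ε₀))
  calc Real.sqrt 2 * (2 * Real.exp ((159 * ((((F.P K).d + 2) * (F.P K).L : ℕ) : ℝ) * (2 * ((F.P K).d : ℝ)))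
              / ((((F.P K).L : ℝ) ^ (F.P K).d)⁻¹ * ((F.P K).L : ℝ)) * (((((F.P K).d + 2) * (F.P K).L : ℕ) : ℝ) ^ 2 / 16 * ε₀)) + 1)
      ≤ 3 / 2 * (2 * (100 / 99) + 1) := mul_le_mul hs (by linarith) (by positivity) (by norm_num)
    _ ≤ 5 := by norm_num

/-! ## §5 ★★★ px17 g10's (P-Q†) rows with (COL) discharged -/

section Discharge

variable (c₀ cB : ℝ) [Fact (0 < c₀)] [Fact (0 < cB)]

/-- ★★★ **THE SUP ROW OF `Q_k(U₀)†` AT A PRINTED-REGULAR BACKGROUND, UNCONDITIONAL**: `RegPr F n K ε₀ U₀`, `10¹⁰L⁶ε₀ ≤ 1`, `10¹²L³ε₀ ≤ 1` ⟹ for every block field `Y` and fine bond `b`,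
`‖toL2⁻¹(Q_k(U₀)†(toL2B Y))(b)‖ ≤ 2·C_Q·(cB∕c₀)·((L:ℝ)^(K−n))⁻¹^3·‖Y‖` — ✓`norm_toL2_symm_adjoint_Qk_apply_le_of_col` with `hcol := col_of_regPr`. [cite: Balaban1985BackgroundPropagators, p.391, (3.16) p.393; Balaban1985Variational, (44)-(45) p.285] -/
theorem norm_toL2_symm_adjoint_Qk_apply_le_of_regPr {ε₀ : ℝ} (hε₀ : 0 < ε₀) (hε : 10 ^ 10 * (F.L : ℝ) ^ 6 * ε₀ ≤ 1) (hε12 : 10 ^ 12 * (F.L : ℝ) ^ 3 * ε₀ ≤ 1)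
    (U₀ : GaugeField (F.P K) 0 (Matrix.specialUnitaryGroup (Fin 2) ℂ)) (hreg : RegPr F n K ε₀ U₀)
    (Y : PBond (F.P n) 0 → Matrix (Fin 2) (Fin 2) ℂ) (b : PBond (F.P K) 0) :
    ‖(toL2 F K c₀).symm (LinearMap.adjoint (Qk F n K h c₀ cB U₀) (toL2B F n cB Y)) b‖
      ≤ 2 * (Real.sqrt 2 * (2 * Real.exp ((159 * ((((F.P K).d + 2) * (F.P K).L : ℕ) : ℝ) * (2 * ((F.P K).d : ℝ)))
              / ((((F.P K).L : ℝ) ^ (F.P K).d)⁻¹ * ((F.P K).L : ℝ)) * (((((F.P K).d + 2) * (F.P K).L : ℕ) : ℝ) ^ 2 / 16 * ε₀)) + 1))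
          * (cB / c₀) * ((F.L : ℝ) ^ (K - n))⁻¹ ^ 3 * ‖Y‖ :=
  norm_toL2_symm_adjoint_Qk_apply_le_of_col F h c₀ cB U₀ (by positivity) (col_of_regPr F h hε₀ hε hε12 U₀ hreg) Y b

/-- ★★★ **THE (Q) LETTER OF O2 AT A PRINTED-REGULAR BACKGROUND, UNCONDITIONAL**: ✓`norm_equiv_adjoint_Qk_smul_Qk_apply_le_of_col_of_regPr` with `hcol := col_of_regPr` — for `0 ≤ a`, every
vector field `u` and every lit-balaban bond `p`, `‖(Q_k(U₀)†((a:ℂ)•Q_k(U₀)u))(p)‖_{W₂} ≤ a·(√2·(2C_Q·(cB∕c₀)·((L:ℝ)^(K−n))⁻¹^3))·(6√(cB∕c₀)√(((L:ℝ)^(K−n))⁻¹^3)∕√cB)·‖u‖`.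
[cite: Balaban1985BackgroundPropagators, (3.26) p.395, (3.42) p.397, Thm 3.11 p.416; Balaban1985Variational, (137) p.298, (138)-(139) p.299] -/
theorem norm_equiv_adjoint_Qk_smul_Qk_apply_le_of_regPr {ε₀ : ℝ} (hε₀ : 0 < ε₀) (hε : 10 ^ 10 * (F.L : ℝ) ^ 6 * ε₀ ≤ 1) (hε12 : 10 ^ 12 * (F.L : ℝ) ^ 3 * ε₀ ≤ 1)
    (U₀ : GaugeField (F.P K) 0 (Matrix.specialUnitaryGroup (Fin 2) ℂ)) (hreg : RegPr F n K ε₀ U₀)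
    {a : ℝ} (ha : 0 ≤ a) (u : BondL2K ℂ 3 (periodsT3 F K) c₀ W₂) (p : Bond 3 (periodsT3 F K)) :
    ‖WL2.equiv ℂ (fun _ : Bond 3 (periodsT3 F K) => c₀) W₂ (LinearMap.adjoint (Qk F n K h c₀ cB U₀) (((a : ℝ) : ℂ) • Qk F n K h c₀ cB U₀ u)) p‖
      ≤ a * (Real.sqrt 2 * (2 * (Real.sqrt 2 * (2 * Real.exp ((159 * ((((F.P K).d + 2) * (F.P K).L : ℕ) : ℝ) * (2 * ((F.P K).d : ℝ)))
              / ((((F.P K).L : ℝ) ^ (F.P K).d)⁻¹ * ((F.P K).L : ℝ)) * (((((F.P K).d + 2) * (F.P K).L : ℕ) : ℝ) ^ 2 / 16 * ε₀)) + 1))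
            * (cB / c₀) * ((F.L : ℝ) ^ (K - n))⁻¹ ^ 3))
          * (6 * Real.sqrt (cB / c₀) * Real.sqrt (((F.L : ℝ) ^ (K - n))⁻¹ ^ 3) / Real.sqrt cB) * ‖u‖ :=
  norm_equiv_adjoint_Qk_smul_Qk_apply_le_of_col_of_regPr F h c₀ cB hε₀ hε hε12 U₀ hreg (by positivity) (col_of_regPr F h hε₀ hε hε12 U₀ hreg) ha u p

end Discharge

end Summit.QuantumFields.YangMills.Theorems.Prop7QTwSColumnBound

end
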